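import Literature.Geometry.Lorentzian.KerrSchildDecay
import Literature.Geometry.Lorentzian.KerrDataSchwarzschildMetric
import HarnessLib

/-!
# The spin enters the Kerr–Schild functions only at second order at infinity

Refinement of `KerrSchildDecay.lean`: on the slice `{t* = 0}` (all quantities read at `(0, z)`,
`ρ = ‖z‖`), the Kerr–Schild building blocks of spin `a` differ from their Schwarzschild (`a = 0`)
counterparts — `r₀ = ρ`, `H₀ = M/ρ`, `ℓ₀ = (1, z/ρ)` — by symbols of lower order, **for every spin
`a` and every mass `M`**:

* the radius: `F − 1 ∈ O_k(ρ⁻²)` for `r² = ρ² F`, hence `r − ρ ∈ O_k(ρ⁻¹)` and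
  `1/r − 1/ρ ∈ O_k(ρ⁻³)` (`Kerr.isBigOSmooth_inv_radius_sub_ofTimeSpace`);
* `H − M/ρ ∈ O_k(ρ⁻³)`, i.e. `H_a − H₀ ∈ O_k(ρ⁻³)` (`Kerr.isBigOSmooth_scalarH_sub_zero_ofTimeSpace`;
  Cook 2000, §3.2.2: `H = M/r + O(r⁻³)`);
* `ℓ_a − ℓ₀ ∈ O_k(ρ⁻¹)` componentwise, as covectors and as vectors
  (`Kerr.isBigOSmooth_nullCovector_sub_zero_ofTimeSpace`, …);
* consequently `g_a − g₀ ∈ O_k(ρ⁻²)` (`Kerr.isBigOSmooth_bilin_sub_zero_ofTimeSpace`),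
  `V_a − V₀ ∈ O_k(ρ⁻²)`, and for the unit normals of the slices `ν_a − ν₀ ∈ O_k(ρ⁻²)`
  (`Kerr.isBigOSmooth_sliceNormalRep_sub_zero_ofTimeSpace`).

These feed the ADM quantities of the Kerr–Schild slice data (energy `M`, momentum `0`), which are
thereby reduced to the closed-form Schwarzschild data of `KerrDataSchwarzschild*.lean`.
García-Parrado–Valiente Kroon, J. Geom. Phys. 58 (2008), §5 (the `a`-dependent corrections are of
relative order `ρ⁻²`); Cook 2000, §3.2.2; Visser arXiv:0706.0622, (32)–(35). Everything is proved;
no definitions, no named facts.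

## References

* A. García-Parrado, J. A. Valiente Kroon, *Kerr initial data*, J. Geom. Phys. 58 (2008), §5.
* G. B. Cook, *Initial data for numerical relativity*, Living Rev. Relativ. 3 (2000) 5, §3.2.2.
* M. Visser, *The Kerr spacetime: a brief introduction*, arXiv:0706.0622, §4, (32)–(35).
-/

noncomputable section

open Set Filter Asymptotics Bornology Topology
open scoped ContDiff RealInnerProductSpace

namespace Literature.Geometry.Lorentzian

namespace Kerr

/-! ### The radius to second order -/

section Radius

variable (a : ℝ)

/-- `F − 1 ∈ O_k(ρ⁻²)` for the factor `F = ½(u + √(u² + 4v))`, `r² = ρ² F`: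
`u − 1 = −a²/ρ²`, `d − 1 = (u − 1)(u + 1) + 4v ∈ O_k(ρ⁻²)` for `d = u² + 4v`, and
`√d − 1 = (d − 1)/(√d + 1)`. [cite: arXiv07060622, (35)] -/
theorem isBigOSmooth_radiusF_sub_one (k : ℕ) : IsBigOSmooth k (-2) fun z : E3 ↦
    (1 - a ^ 2 * ‖z‖⁻¹ ^ 2 +
      √((1 - a ^ 2 * ‖z‖⁻¹ ^ 2) ^ 2 + 4 * (a ^ 2 * (z 2 ^ 2 * ‖z‖⁻¹ ^ 4)))) / 2 - 1 := by
  have hu1 : IsBigOSmooth k (-2) fun z : E3 ↦ 1 - a ^ 2 * ‖z‖⁻¹ ^ 2 - 1 := by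
    have h := ((isBigOSmooth_inv_norm_sq k).const_mul (a ^ 2)).neg
    exact h.congr fun z ↦ by ring
  have hd1 : IsBigOSmooth k (-2) fun z : E3 ↦
      (1 - a ^ 2 * ‖z‖⁻¹ ^ 2) ^ 2 + 4 * (a ^ 2 * (z 2 ^ 2 * ‖z‖⁻¹ ^ 4)) - 1 := by
    have h := hu1.mul ((isBigOSmooth_radiusU a k).add (isBigOSmooth_const k (1 : ℝ)))
    rw [show (-2 : ℝ) + 0 = -2 by norm_num] at h
    exact (h.add ((isBigOSmooth_radiusV a k).const_mul 4)).congr fun z ↦ by ring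
  have hsd : Tendsto (fun z : E3 ↦ √((1 - a ^ 2 * ‖z‖⁻¹ ^ 2) ^ 2 +
      4 * (a ^ 2 * (z 2 ^ 2 * ‖z‖⁻¹ ^ 4))) + 1) (cobounded E3) (𝓝 2) := by
    have h := (IsBigOSmooth.tendsto_sqrt_one (tendsto_radiusDiscr a)).add_const 1
    rw [show (1 : ℝ) + 1 = 2 by norm_num] at h
    exact h
  have hinv : IsBigOSmooth k 0 fun z : E3 ↦ (√((1 - a ^ 2 * ‖z‖⁻¹ ^ 2) ^ 2 +
      4 * (a ^ 2 * (z 2 ^ 2 * ‖z‖⁻¹ ^ 4))) + 1)⁻¹ :=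
    (((isBigOSmooth_radiusDiscr a k).sqrt (tendsto_radiusDiscr a)).add
      (isBigOSmooth_const k (1 : ℝ))).inv_of_tendsto hsd two_ne_zero
  have hsq1 : IsBigOSmooth k (-2) fun z : E3 ↦ √((1 - a ^ 2 * ‖z‖⁻¹ ^ 2) ^ 2 +
      4 * (a ^ 2 * (z 2 ^ 2 * ‖z‖⁻¹ ^ 4))) - 1 := by
    have h := hd1.mul hinv
    rw [add_zero] at h
    refine h.congr fun z ↦ ?_
    set d : ℝ := (1 - a ^ 2 * ‖z‖⁻¹ ^ 2) ^ 2 + 4 * (a ^ 2 * (z 2 ^ 2 * ‖z‖⁻¹ ^ 4)) with hd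
    have hd0 : 0 ≤ d := by positivity
    have hs : √d * √d = d := Real.mul_self_sqrt hd0
    have h1 : √d + 1 ≠ 0 := by positivity
    rw [mul_inv_eq_iff_eq_mul₀ h1]
    linear_combination (-1 : ℝ) * hs
  have h := (hu1.add hsq1).const_mul 2⁻¹
  exact h.congr fun z ↦ by ring

/-- `√F − 1 = (F − 1)/(√F + 1) ∈ O_k(ρ⁻²)`. [cite: arXiv07060622, (35)] -/
theorem isBigOSmooth_sqrt_radiusF_sub_one (k : ℕ) : IsBigOSmooth k (-2) fun z : E3 ↦
    √((1 - a ^ 2 * ‖z‖⁻¹ ^ 2 +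
      √((1 - a ^ 2 * ‖z‖⁻¹ ^ 2) ^ 2 + 4 * (a ^ 2 * (z 2 ^ 2 * ‖z‖⁻¹ ^ 4)))) / 2) - 1 := by
  have hs1 : Tendsto (fun z : E3 ↦ √((1 - a ^ 2 * ‖z‖⁻¹ ^ 2 +
      √((1 - a ^ 2 * ‖z‖⁻¹ ^ 2) ^ 2 + 4 * (a ^ 2 * (z 2 ^ 2 * ‖z‖⁻¹ ^ 4)))) / 2) + 1)
      (cobounded E3) (𝓝 2) := by
    have h := (IsBigOSmooth.tendsto_sqrt_one (tendsto_radiusF a)).add_const 1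
    rw [show (1 : ℝ) + 1 = 2 by norm_num] at h
    exact h
  have hinv := (((isBigOSmooth_radiusF a k).sqrt (tendsto_radiusF a)).add
    (isBigOSmooth_const k (1 : ℝ))).inv_of_tendsto hs1 two_ne_zero
  have h := (isBigOSmooth_radiusF_sub_one a k).mul hinv
  rw [add_zero] at h
  refine h.congr fun z ↦ ?_
  set F : ℝ := (1 - a ^ 2 * ‖z‖⁻¹ ^ 2 +
      √((1 - a ^ 2 * ‖z‖⁻¹ ^ 2) ^ 2 + 4 * (a ^ 2 * (z 2 ^ 2 * ‖z‖⁻¹ ^ 4)))) / 2 with hF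
  have hF0 : 0 ≤ F := radiusF_nonneg a z
  have hs : √F * √F = F := Real.mul_self_sqrt hF0
  have h1 : √F + 1 ≠ 0 := by positivity
  rw [mul_inv_eq_iff_eq_mul₀ h1]
  linear_combination (-1 : ℝ) * hs

/-- `(√F)⁻¹ − 1 = (1 − √F)/√F ∈ O_k(ρ⁻²)` (far out `F > 0`). [cite: arXiv07060622, (35)] -/
theorem isBigOSmooth_inv_sqrt_radiusF_sub_one (k : ℕ) : IsBigOSmooth k (-2) fun z : E3 ↦
    (√((1 - a ^ 2 * ‖z‖⁻¹ ^ 2 +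
      √((1 - a ^ 2 * ‖z‖⁻¹ ^ 2) ^ 2 + 4 * (a ^ 2 * (z 2 ^ 2 * ‖z‖⁻¹ ^ 4)))) / 2))⁻¹ - 1 := by
  have hinv := ((isBigOSmooth_radiusF a k).sqrt (tendsto_radiusF a)).inv
    (IsBigOSmooth.tendsto_sqrt_one (tendsto_radiusF a))
  have h := (isBigOSmooth_sqrt_radiusF_sub_one a k).neg.mul hinv
  rw [add_zero] at h
  obtain ⟨R₁, hR₁⟩ := exists_radius_of_eventually_cobounded
    ((tendsto_radiusF a).eventually (Ioi_mem_nhds (by norm_num : (0 : ℝ) < 1)))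
  refine h.congr_far (R₁ := R₁) fun z hz ↦ ?_
  have hF : 0 < (1 - a ^ 2 * ‖z‖⁻¹ ^ 2 +
      √((1 - a ^ 2 * ‖z‖⁻¹ ^ 2) ^ 2 + 4 * (a ^ 2 * (z 2 ^ 2 * ‖z‖⁻¹ ^ 4)))) / 2 := hR₁ z hz
  set t : ℝ := √((1 - a ^ 2 * ‖z‖⁻¹ ^ 2 +
      √((1 - a ^ 2 * ‖z‖⁻¹ ^ 2) ^ 2 + 4 * (a ^ 2 * (z 2 ^ 2 * ‖z‖⁻¹ ^ 4)))) / 2) with ht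
  have hs : t ≠ 0 := (Real.sqrt_pos.2 hF).ne'
  rw [show -(t - 1) * t⁻¹ = t⁻¹ - t * t⁻¹ by ring, mul_inv_cancel₀ hs]

/-- **`1/r − 1/ρ ∈ O_k(ρ⁻³)`** on the slice: `1/r = ρ⁻¹ (√F)⁻¹`. [cite: arXiv07060622, (35)] -/
theorem isBigOSmooth_inv_radius_sub_ofTimeSpace (k : ℕ) :
    IsBigOSmooth k (-3) fun z : E3 ↦ (radius a (E4.ofTimeSpace 0 z))⁻¹ - ‖z‖⁻¹ := by
  have h := (isBigOSmooth_inv_norm_all (E' := E3) k).mul (isBigOSmooth_inv_sqrt_radiusF_sub_one a k)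
  rw [show (-1 : ℝ) + -2 = -3 by norm_num] at h
  refine h.congr_far (R₁ := 0) fun z hz ↦ ?_
  rw [radius_ofTimeSpace_eq_norm_mul a (norm_pos_iff.1 hz), mul_inv]
  ring

/-- **`r − ρ ∈ O_k(ρ⁻¹)`** on the slice: `r = ρ √F`. [cite: arXiv07060622, (35)] -/
theorem isBigOSmooth_radius_sub_ofTimeSpace (k : ℕ) :
    IsBigOSmooth k (-1) fun z : E3 ↦ radius a (E4.ofTimeSpace 0 z) - ‖z‖ := by
  have h := (isBigOSmooth_norm (E' := E3) k).mul (isBigOSmooth_sqrt_radiusF_sub_one a k)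
  rw [show (1 : ℝ) + -2 = -1 by norm_num] at h
  refine h.congr_far (R₁ := 0) fun z hz ↦ ?_
  rw [radius_ofTimeSpace_eq_norm_mul a (norm_pos_iff.1 hz)]
  ring

/-- `1/r_a − 1/r₀ ∈ O_k(ρ⁻³)` (`r₀ = ρ`). [cite: arXiv07060622, (35)] -/
theorem isBigOSmooth_inv_radius_sub_zero_ofTimeSpace (k : ℕ) :
    IsBigOSmooth k (-3) fun z : E3 ↦
      (radius a (E4.ofTimeSpace 0 z))⁻¹ - (radius 0 (E4.ofTimeSpace 0 z))⁻¹ :=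
  (isBigOSmooth_inv_radius_sub_ofTimeSpace a k).congr fun z ↦ by rw [radius_zero_ofTimeSpace]

/-- `r_a − r₀ ∈ O_k(ρ⁻¹)`. [cite: arXiv07060622, (35)] -/
theorem isBigOSmooth_radius_sub_zero_ofTimeSpace (k : ℕ) :
    IsBigOSmooth k (-1) fun z : E3 ↦ radius a (E4.ofTimeSpace 0 z) - radius 0 (E4.ofTimeSpace 0 z) :=
  (isBigOSmooth_radius_sub_ofTimeSpace a k).congr fun z ↦ by rw [radius_zero_ofTimeSpace]

end Radius

/-! ### `H` to second order -/

section ScalarH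

variable (M a : ℝ)

/-- **`H − M/ρ ∈ O_k(ρ⁻³)`**: far out `H = M r⁻¹ (1 + w)⁻¹` with `w = a² z₃² r⁻⁴ ≥ 0`,
`(1 + w)⁻¹ − 1 = −w (1 + w)⁻¹ ∈ O_k(ρ⁻²)` and `1/r − 1/ρ ∈ O_k(ρ⁻³)`. Cook 2000, §3.2.2
(`H = M/r + O(r⁻³)`); García-Parrado–Valiente Kroon 2008, §5. [cite: Cook2000, §3.2.2] -/
theorem isBigOSmooth_scalarH_sub_ofTimeSpace (k : ℕ) :
    IsBigOSmooth k (-3) fun z : E3 ↦ scalarH M a (E4.ofTimeSpace 0 z) - M * ‖z‖⁻¹ := by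
  -- `w = a² z₃² r⁻⁴ ∈ O_k(ρ⁻²)`
  have hw : IsBigOSmooth k (-2) fun z : E3 ↦
      a ^ 2 * (z 2 ^ 2 * (radius a (E4.ofTimeSpace 0 z))⁻¹ ^ 4) := by
    have h := (((isBigOSmooth_coord 2 k).mul (isBigOSmooth_coord 2 k)).mul
      (isBigOSmooth_inv_radius_pow_ofTimeSpace a k 4)).const_mul (a ^ 2)
    rw [show (1 : ℝ) + 1 + -((4 : ℕ) : ℝ) = -2 by norm_num] at h
    exact h.congr fun z ↦ by ring
  have hw1 : Tendsto (fun z : E3 ↦ 1 + a ^ 2 * (z 2 ^ 2 * (radius a (E4.ofTimeSpace 0 z))⁻¹ ^ 4))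
      (cobounded E3) (𝓝 1) := hw.tendsto_const_add (by norm_num) 1
  have hinv := ((isBigOSmooth_const k (1 : ℝ)).add (hw.mono (by norm_num))).inv hw1
  -- `(1 + w)⁻¹ − 1 = −w (1 + w)⁻¹`
  have hinv1 : IsBigOSmooth k (-2) fun z : E3 ↦
      (1 + a ^ 2 * (z 2 ^ 2 * (radius a (E4.ofTimeSpace 0 z))⁻¹ ^ 4))⁻¹ - 1 := by
    have h := hw.neg.mul hinv
    rw [add_zero] at h
    refine h.congr fun z ↦ ?_
    have h1 : 1 + a ^ 2 * (z 2 ^ 2 * (radius a (E4.ofTimeSpace 0 z))⁻¹ ^ 4) ≠ 0 := by positivity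
    field_simp
    ring
  have hA := ((isBigOSmooth_const k M).mul (isBigOSmooth_inv_radius_ofTimeSpace a k)).mul hinv1
  have hB := (isBigOSmooth_inv_radius_sub_ofTimeSpace a k).const_mul M
  rw [show (0 : ℝ) + -1 + -2 = -3 by norm_num] at hA
  obtain ⟨R₁, hR₁⟩ := exists_radius_of_eventually_cobounded (eventually_radius_ofTimeSpace_pos a)
  refine (hA.add hB).congr_far (R₁ := R₁) fun z hz ↦ ?_
  have hr : 0 < radius a (E4.ofTimeSpace 0 z) := hR₁ z hz
  have hr0 : radius a (E4.ofTimeSpace 0 z) ≠ 0 := hr.ne'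
  rw [scalarH, ofTimeSpace_zero_apply_three]
  have hden : radius a (E4.ofTimeSpace 0 z) ^ 4 + a ^ 2 * z 2 ^ 2 ≠ 0 := by positivity
  have h1 : 1 + a ^ 2 * (z 2 ^ 2 * (radius a (E4.ofTimeSpace 0 z))⁻¹ ^ 4) ≠ 0 := by positivity
  field_simp
  ring

/-- **`H_a − H₀ ∈ O_k(ρ⁻³)`**: the spin enters `H` only at relative order `ρ⁻²`.
García-Parrado–Valiente Kroon 2008, §5. [cite: Cook2000, §3.2.2] -/
theorem isBigOSmooth_scalarH_sub_zero_ofTimeSpace (k : ℕ) :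
    IsBigOSmooth k (-3) fun z : E3 ↦ scalarH M a (E4.ofTimeSpace 0 z) - scalarH M 0 (E4.ofTimeSpace 0 z) :=
  (isBigOSmooth_scalarH_sub_ofTimeSpace M a k).congr_far (R₁ := 0) fun z hz ↦ by
    rw [scalarH_zero_ofTimeSpace M (norm_pos_iff.1 hz), div_eq_mul_inv]

end ScalarH

/-! ### `ℓ` to first order -/

section Null

variable (a : ℝ)

/-- The coefficient `r/(r² + a²) − 1/ρ ∈ O_k(ρ⁻³)`:
`r/(r² + a²) − 1/r = −a² r⁻³ (1 + a² r⁻²)⁻¹` and `1/r − 1/ρ ∈ O_k(ρ⁻³)`. [cite: arXiv07060622, (34)] -/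
theorem isBigOSmooth_radius_div_sub_ofTimeSpace (k : ℕ) :
    IsBigOSmooth k (-3) fun z : E3 ↦
      radius a (E4.ofTimeSpace 0 z) * (radius a (E4.ofTimeSpace 0 z) ^ 2 + a ^ 2)⁻¹ - ‖z‖⁻¹ := by
  have hw : IsBigOSmooth k (-2) fun z : E3 ↦ a ^ 2 * (radius a (E4.ofTimeSpace 0 z))⁻¹ ^ 2 := by
    simpa using (isBigOSmooth_inv_radius_pow_ofTimeSpace a k 2).const_mul (a ^ 2)
  have hw1 : Tendsto (fun z : E3 ↦ 1 + a ^ 2 * (radius a (E4.ofTimeSpace 0 z))⁻¹ ^ 2)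
      (cobounded E3) (𝓝 1) := hw.tendsto_const_add (by norm_num) 1
  have hinv := ((isBigOSmooth_const k (1 : ℝ)).add (hw.mono (by norm_num))).inv hw1
  have hA := ((isBigOSmooth_inv_radius_ofTimeSpace a k).mul hw.neg).mul hinv
  rw [show (-1 : ℝ) + -2 + 0 = -3 by norm_num] at hA
  have h := hA.add (isBigOSmooth_inv_radius_sub_ofTimeSpace a k)
  obtain ⟨R₁, hR₁⟩ := exists_radius_of_eventually_cobounded (eventually_radius_ofTimeSpace_pos a)
  refine h.congr_far (R₁ := R₁) fun z hz ↦ ?_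
  have hr0 : radius a (E4.ofTimeSpace 0 z) ≠ 0 := (hR₁ z hz).ne'
  have hden : radius a (E4.ofTimeSpace 0 z) ^ 2 + a ^ 2 ≠ 0 := by positivity
  have h1 : 1 + a ^ 2 * (radius a (E4.ofTimeSpace 0 z))⁻¹ ^ 2 ≠ 0 := by positivity
  field_simp
  ring

/-- `ℓ₁ − z₁/ρ ∈ O_k(ρ⁻¹)`: `ℓ₁ − z₁/ρ = z₁ (r/(r²+a²) − 1/ρ) + a z₂/(r² + a²)`.
[cite: arXiv07060622, (34)] -/
theorem isBigOSmooth_nullCovectorFun_one_sub (k : ℕ) :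
    IsBigOSmooth k (-1) fun z : E3 ↦ nullCovectorFun a (E4.ofTimeSpace 0 z) 1 - z 0 * ‖z‖⁻¹ := by
  have hA := (isBigOSmooth_coord 0 k).mul (isBigOSmooth_radius_div_sub_ofTimeSpace a k)
  have hB := ((isBigOSmooth_coord 1 k).mul (isBigOSmooth_inv_radius_sq_add_sq a k)).const_mul a
  rw [show (1 : ℝ) + -3 = -2 by norm_num] at hA
  rw [show (1 : ℝ) + -2 = -1 by norm_num] at hB
  refine ((hA.mono (by norm_num)).add hB).congr fun z ↦ ?_
  rw [nullCovectorFun_apply_one, ofTimeSpace_zero_apply_one, ofTimeSpace_zero_apply_two,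
    div_eq_mul_inv]
  ring

/-- `ℓ₂ − z₂/ρ ∈ O_k(ρ⁻¹)`. [cite: arXiv07060622, (34)] -/
theorem isBigOSmooth_nullCovectorFun_two_sub (k : ℕ) :
    IsBigOSmooth k (-1) fun z : E3 ↦ nullCovectorFun a (E4.ofTimeSpace 0 z) 2 - z 1 * ‖z‖⁻¹ := by
  have hA := (isBigOSmooth_coord 1 k).mul (isBigOSmooth_radius_div_sub_ofTimeSpace a k)
  have hB := ((isBigOSmooth_coord 0 k).mul (isBigOSmooth_inv_radius_sq_add_sq a k)).const_mul a
  rw [show (1 : ℝ) + -3 = -2 by norm_num] at hA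
  rw [show (1 : ℝ) + -2 = -1 by norm_num] at hB
  refine ((hA.mono (by norm_num)).sub hB).congr fun z ↦ ?_
  rw [nullCovectorFun_apply_two, ofTimeSpace_zero_apply_one, ofTimeSpace_zero_apply_two,
    div_eq_mul_inv]
  ring

/-- `ℓ₃ − z₃/ρ = z₃ (1/r − 1/ρ) ∈ O_k(ρ⁻²)`. [cite: arXiv07060622, (34)] -/
theorem isBigOSmooth_nullCovectorFun_three_sub (k : ℕ) :
    IsBigOSmooth k (-2) fun z : E3 ↦ nullCovectorFun a (E4.ofTimeSpace 0 z) 3 - z 2 * ‖z‖⁻¹ := by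
  have h := (isBigOSmooth_coord 2 k).mul (isBigOSmooth_inv_radius_sub_ofTimeSpace a k)
  rw [show (1 : ℝ) + -3 = -2 by norm_num] at h
  refine h.congr fun z ↦ ?_
  rw [nullCovectorFun_apply_three, ofTimeSpace_zero_apply_three, div_eq_mul_inv]
  ring

/-- At `a = 0`: `ℓ₁ = z₁/ρ` on the slice. [cite: arXiv07060622, (34)] -/
theorem nullCovectorFun_zero_ofTimeSpace_one {z : E3} (hz : z ≠ 0) :
    nullCovectorFun 0 (E4.ofTimeSpace 0 z) 1 = z 0 * ‖z‖⁻¹ := by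
  have hr : ‖z‖ ≠ 0 := norm_ne_zero_iff.2 hz
  rw [nullCovectorFun_apply_one, radius_zero_ofTimeSpace, ofTimeSpace_zero_apply_one]
  field_simp
  ring

/-- At `a = 0`: `ℓ₂ = z₂/ρ` on the slice. [cite: arXiv07060622, (34)] -/
theorem nullCovectorFun_zero_ofTimeSpace_two {z : E3} (hz : z ≠ 0) :
    nullCovectorFun 0 (E4.ofTimeSpace 0 z) 2 = z 1 * ‖z‖⁻¹ := by
  have hr : ‖z‖ ≠ 0 := norm_ne_zero_iff.2 hz
  rw [nullCovectorFun_apply_two, radius_zero_ofTimeSpace, ofTimeSpace_zero_apply_two]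
  field_simp
  ring

/-- At `a = 0`: `ℓ₃ = z₃/ρ` on the slice. [cite: arXiv07060622, (34)] -/
theorem nullCovectorFun_zero_ofTimeSpace_three (z : E3) :
    nullCovectorFun 0 (E4.ofTimeSpace 0 z) 3 = z 2 * ‖z‖⁻¹ := by
  rw [nullCovectorFun_apply_three, radius_zero_ofTimeSpace, ofTimeSpace_zero_apply_three,
    div_eq_mul_inv]

/-- **`ℓ_a − ℓ₀ ∈ O_k(ρ⁻¹)` componentwise**: the spin enters the null covector at relative order
`ρ⁻¹`. García-Parrado–Valiente Kroon 2008, §5. [cite: arXiv07060622, (34)] -/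
theorem isBigOSmooth_nullCovectorFun_sub_zero_ofTimeSpace (k : ℕ) (μ : Fin 4) :
    IsBigOSmooth k (-1) fun z : E3 ↦
      nullCovectorFun a (E4.ofTimeSpace 0 z) μ - nullCovectorFun 0 (E4.ofTimeSpace 0 z) μ := by
  fin_cases μ
  · exact (isBigOSmooth_zero k (-1)).congr fun z ↦ by
      simp [nullCovectorFun_apply_zero]
  · refine (isBigOSmooth_nullCovectorFun_one_sub a k).congr_far (R₁ := 0) fun z hz ↦ ?_
    simp only [Fin.mk_one]
    rw [nullCovectorFun_zero_ofTimeSpace_one (norm_pos_iff.1 hz)]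
  · refine (isBigOSmooth_nullCovectorFun_two_sub a k).congr_far (R₁ := 0) fun z hz ↦ ?_
    simp only [Fin.reduceFinMk]
    rw [nullCovectorFun_zero_ofTimeSpace_two (norm_pos_iff.1 hz)]
  · refine ((isBigOSmooth_nullCovectorFun_three_sub a k).mono (by norm_num)).congr fun z ↦ ?_
    simp only [Fin.reduceFinMk]
    rw [nullCovectorFun_zero_ofTimeSpace_three]

/-- **`ℓ_a − ℓ₀ ∈ O_k(ρ⁻¹)` as covectors.** [cite: arXiv07060622, (34)] -/
theorem isBigOSmooth_nullCovector_sub_zero_ofTimeSpace (k : ℕ) :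
    IsBigOSmooth k (-1) fun z : E3 ↦
      nullCovector a (E4.ofTimeSpace 0 z) - nullCovector 0 (E4.ofTimeSpace 0 z) := by
  have h := IsBigOSmooth.finset_sum (Finset.univ : Finset (Fin 4)) fun μ _ ↦
    (isBigOSmooth_nullCovectorFun_sub_zero_ofTimeSpace a k μ).smul_const (E4.dx μ)
  refine h.congr fun z ↦ ?_
  show ∑ μ, _ = E4.covector _ - E4.covector _
  simp only [E4.covector, ← Finset.sum_sub_distrib, sub_smul]

/-- **`ℓ♯_a − ℓ♯₀ ∈ O_k(ρ⁻¹)` as vectors.** [cite: arXiv07060622, (34)] -/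
theorem isBigOSmooth_nullVector_sub_zero_ofTimeSpace (k : ℕ) :
    IsBigOSmooth k (-1) fun z : E3 ↦
      nullVector a (E4.ofTimeSpace 0 z) - nullVector 0 (E4.ofTimeSpace 0 z) := by
  refine IsBigOSmooth.of_apply_E4 fun μ ↦ ?_
  have h := (isBigOSmooth_nullCovectorFun_sub_zero_ofTimeSpace a k μ).const_mul
    (if μ = 0 then -1 else 1)
  refine h.congr fun z ↦ ?_
  show _ = (nullVector a (E4.ofTimeSpace 0 z) - nullVector 0 (E4.ofTimeSpace 0 z)) μ
  rw [PiLp.sub_apply, nullVector_apply, nullVector_apply]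
  ring

end Null

/-! ### The metric, `V` and the unit normal to second order -/

section Metric

variable (M a : ℝ)

/-- **`g_a − g₀ ∈ O_k(ρ⁻²)`**: `2H_aℓ_a⊗ℓ_a − 2H₀ℓ₀⊗ℓ₀ = 2(H_a − H₀)ℓ_a⊗ℓ_a + 2H₀((ℓ_a − ℓ₀)⊗ℓ_a + ℓ₀⊗(ℓ_a − ℓ₀))`
with `H_a − H₀ ∈ O_k(ρ⁻³)`, `H₀ ∈ O_k(ρ⁻¹)`, `ℓ_a − ℓ₀ ∈ O_k(ρ⁻¹)`. García-Parrado–Valiente Kroon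
2008, §5 (`h_ij = δ_ij + 2M xᵢxⱼ/r³ + O(r⁻²)`). [cite: Cook2000, §3.2.2 (55)] -/
theorem isBigOSmooth_bilin_sub_zero_ofTimeSpace (k : ℕ) :
    IsBigOSmooth k (-2) fun z : E3 ↦ bilin M a (E4.ofTimeSpace 0 z) - bilin M 0 (E4.ofTimeSpace 0 z) := by
  have hℓa := isBigOSmooth_nullCovector_ofTimeSpace a k
  have hℓ0 := isBigOSmooth_nullCovector_ofTimeSpace 0 k
  have hdℓ := isBigOSmooth_nullCovector_sub_zero_ofTimeSpace a k
  -- `ℓ_a ⊗ ℓ_a ∈ O_k(1)` and `ℓ_a ⊗ ℓ_a − ℓ₀ ⊗ ℓ₀ = (ℓ_a − ℓ₀) ⊗ ℓ_a + ℓ₀ ⊗ (ℓ_a − ℓ₀) ∈ O_k(ρ⁻¹)`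
  have hTa : IsBigOSmooth k 0 fun z : E3 ↦
      E4.tmul (nullCovector a (E4.ofTimeSpace 0 z)) (nullCovector a (E4.ofTimeSpace 0 z)) :=
    (hℓa.bilin₀ (ContinuousLinearMap.smulRightL ℝ E4 (E4 →L[ℝ] ℝ)) hℓa).congr fun _ ↦ rfl
  have hdT : IsBigOSmooth k (-1) fun z : E3 ↦
      E4.tmul (nullCovector a (E4.ofTimeSpace 0 z)) (nullCovector a (E4.ofTimeSpace 0 z)) -
        E4.tmul (nullCovector 0 (E4.ofTimeSpace 0 z)) (nullCovector 0 (E4.ofTimeSpace 0 z)) := by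
    have h1 : IsBigOSmooth k (-1 + 0) fun z : E3 ↦
        E4.tmul (nullCovector a (E4.ofTimeSpace 0 z) - nullCovector 0 (E4.ofTimeSpace 0 z))
          (nullCovector a (E4.ofTimeSpace 0 z)) :=
      (hdℓ.bilin (ContinuousLinearMap.smulRightL ℝ E4 (E4 →L[ℝ] ℝ)) hℓa).congr fun _ ↦ rfl
    have h2 : IsBigOSmooth k (0 + -1) fun z : E3 ↦
        E4.tmul (nullCovector 0 (E4.ofTimeSpace 0 z))
          (nullCovector a (E4.ofTimeSpace 0 z) - nullCovector 0 (E4.ofTimeSpace 0 z)) :=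
      (hℓ0.bilin (ContinuousLinearMap.smulRightL ℝ E4 (E4 →L[ℝ] ℝ)) hdℓ).congr fun _ ↦ rfl
    rw [show (-1 : ℝ) + 0 = -1 by norm_num] at h1
    rw [show (0 : ℝ) + -1 = -1 by norm_num] at h2
    refine (h1.add h2).congr fun z ↦ ?_
    ext v w
    simp only [_root_.add_apply, _root_.sub_apply, E4.tmul_apply]
    ring
  have hA := ((isBigOSmooth_scalarH_sub_zero_ofTimeSpace M a k).const_mul 2).smul hTa
  have hC := ((isBigOSmooth_scalarH_ofTimeSpace M 0 k).const_mul 2).smul hdT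
  rw [show (-3 : ℝ) + 0 = -3 by norm_num] at hA
  rw [show (-1 : ℝ) + -1 = -2 by norm_num] at hC
  refine ((hA.mono (by norm_num)).add hC).congr fun z ↦ ?_
  set Ta := E4.tmul (nullCovector a (E4.ofTimeSpace 0 z)) (nullCovector a (E4.ofTimeSpace 0 z))
  set T0 := E4.tmul (nullCovector 0 (E4.ofTimeSpace 0 z)) (nullCovector 0 (E4.ofTimeSpace 0 z))
  rw [bilin, bilin]
  module

/-- **`V_a − V₀ ∈ O_k(ρ⁻²)`** for `V = ∂_{t*} − 2Hℓ♯`. [cite: Cook2000, §3.2.2] -/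
theorem isBigOSmooth_timeVector_sub_zero_ofTimeSpace (k : ℕ) :
    IsBigOSmooth k (-2) fun z : E3 ↦
      timeVector M a (E4.ofTimeSpace 0 z) - timeVector M 0 (E4.ofTimeSpace 0 z) := by
  have hA := ((isBigOSmooth_scalarH_sub_zero_ofTimeSpace M a k).const_mul 2).smul
    (isBigOSmooth_nullVector_ofTimeSpace a k)
  have hC := ((isBigOSmooth_scalarH_ofTimeSpace M 0 k).const_mul 2).smul
    (isBigOSmooth_nullVector_sub_zero_ofTimeSpace a k)
  rw [show (-3 : ℝ) + 0 = -3 by norm_num] at hA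
  rw [show (-1 : ℝ) + -1 = -2 by norm_num] at hC
  refine ((hA.mono (by norm_num)).add hC).neg.congr fun z ↦ ?_
  rw [timeVector, timeVector]
  module

/-- **The lapse factors differ at order `ρ⁻³`**: `(1 + 2H_a)^{-1/2} − (1 + 2H₀)^{-1/2} ∈ O_k(ρ⁻³)`
(far out both radicands are positive and `1/s − 1/t = (t² − s²)/(st(s + t))` with
`t² − s² = 2(H₀ − H_a)`). [cite: Cook2000, §3.2.2] -/
theorem isBigOSmooth_lapse_sub_zero_ofTimeSpace (k : ℕ) :
    IsBigOSmooth k (-3) fun z : E3 ↦ (√(1 + 2 * scalarH M a (E4.ofTimeSpace 0 z)))⁻¹ -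
      (√(1 + 2 * scalarH M 0 (E4.ofTimeSpace 0 z)))⁻¹ := by
  have hqa1 : Tendsto (fun z : E3 ↦ 1 + 2 * scalarH M a (E4.ofTimeSpace 0 z)) (cobounded E3) (𝓝 1) :=
    ((isBigOSmooth_scalarH_ofTimeSpace M a 0).const_mul 2).tendsto_const_add (by norm_num) 1
  have hq01 : Tendsto (fun z : E3 ↦ 1 + 2 * scalarH M 0 (E4.ofTimeSpace 0 z)) (cobounded E3) (𝓝 1) :=
    ((isBigOSmooth_scalarH_ofTimeSpace M 0 0).const_mul 2).tendsto_const_add (by norm_num) 1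
  have hqa : IsBigOSmooth k 0 fun z : E3 ↦ 1 + 2 * scalarH M a (E4.ofTimeSpace 0 z) :=
    (isBigOSmooth_const k (1 : ℝ)).add
      (((isBigOSmooth_scalarH_ofTimeSpace M a k).const_mul 2).mono (by norm_num))
  have hq0 : IsBigOSmooth k 0 fun z : E3 ↦ 1 + 2 * scalarH M 0 (E4.ofTimeSpace 0 z) :=
    (isBigOSmooth_const k (1 : ℝ)).add
      (((isBigOSmooth_scalarH_ofTimeSpace M 0 k).const_mul 2).mono (by norm_num))
  have hsa := isBigOSmooth_lapse_ofTimeSpace M a k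
  have hs0 := isBigOSmooth_lapse_ofTimeSpace M 0 k
  have hsum1 : Tendsto (fun z : E3 ↦ √(1 + 2 * scalarH M a (E4.ofTimeSpace 0 z)) +
      √(1 + 2 * scalarH M 0 (E4.ofTimeSpace 0 z))) (cobounded E3) (𝓝 2) := by
    have h := (IsBigOSmooth.tendsto_sqrt_one hqa1).add (IsBigOSmooth.tendsto_sqrt_one hq01)
    rw [show (1 : ℝ) + 1 = 2 by norm_num] at h
    exact h
  have hinv := ((hqa.sqrt hqa1).add (hq0.sqrt hq01)).inv_of_tendsto hsum1 two_ne_zero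
  have hnum : IsBigOSmooth k (-3) fun z : E3 ↦
      2 * (scalarH M 0 (E4.ofTimeSpace 0 z) - scalarH M a (E4.ofTimeSpace 0 z)) := by
    have h := ((isBigOSmooth_scalarH_sub_zero_ofTimeSpace M a k).const_mul 2).neg
    exact h.congr fun z ↦ by ring
  have h := ((hnum.mul hsa).mul hs0).mul hinv
  rw [show (-3 : ℝ) + 0 + 0 + 0 = -3 by norm_num] at h
  obtain ⟨R₁, hR₁⟩ := exists_radius_of_eventually_cobounded
    ((hqa1.eventually (Ioi_mem_nhds (by norm_num : (0 : ℝ) < 1))).and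
      (hq01.eventually (Ioi_mem_nhds (by norm_num : (0 : ℝ) < 1))))
  refine h.congr_far (R₁ := R₁) fun z hz ↦ ?_
  obtain ⟨hza, hz0⟩ := hR₁ z hz
  set s : ℝ := √(1 + 2 * scalarH M a (E4.ofTimeSpace 0 z)) with hs_def
  set t : ℝ := √(1 + 2 * scalarH M 0 (E4.ofTimeSpace 0 z)) with ht_def
  have hs : s * s = 1 + 2 * scalarH M a (E4.ofTimeSpace 0 z) := Real.mul_self_sqrt hza.le
  have ht : t * t = 1 + 2 * scalarH M 0 (E4.ofTimeSpace 0 z) := Real.mul_self_sqrt hz0.le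
  have hs0' : s ≠ 0 := (Real.sqrt_pos.2 hza).ne'
  have ht0' : t ≠ 0 := (Real.sqrt_pos.2 hz0).ne'
  have hst : s + t ≠ 0 := by positivity
  field_simp
  linear_combination hs - ht

/-- **The unit normals of the slices differ at order `ρ⁻²`**: for the representatives
`N = (1 + 2H)^{-1/2} V`, `N_a − N₀ = (s_a − s₀) V_a + s₀ (V_a − V₀) ∈ O_k(ρ⁻²)`.
García-Parrado–Valiente Kroon 2008, §5. [cite: Cook2000, §3.2.2] -/
theorem isBigOSmooth_sliceNormalRep_sub_zero_ofTimeSpace (k : ℕ) :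
    IsBigOSmooth k (-2) fun z : E3 ↦
      (√(1 + 2 * scalarH M a (E4.ofTimeSpace 0 z)))⁻¹ • timeVector M a (E4.ofTimeSpace 0 z) -
        (√(1 + 2 * scalarH M 0 (E4.ofTimeSpace 0 z)))⁻¹ • timeVector M 0 (E4.ofTimeSpace 0 z) := by
  have hA := (isBigOSmooth_lapse_sub_zero_ofTimeSpace M a k).smul (isBigOSmooth_timeVector_ofTimeSpace M a k)
  have hC := (isBigOSmooth_lapse_ofTimeSpace M 0 k).smul (isBigOSmooth_timeVector_sub_zero_ofTimeSpace M a k)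
  rw [show (-3 : ℝ) + 0 = -3 by norm_num] at hA
  rw [show (0 : ℝ) + -2 = -2 by norm_num] at hC
  refine ((hA.mono (by norm_num)).add hC).congr fun z ↦ ?_
  rw [sub_smul, smul_sub]
  abel

end Metric

end Kerr

end Literature.Geometry.Lorentzian

end
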